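import Literature.AlgebraicGeometry.Motives.MumfordTateGroupOfOrientationSerreGroupLeastLevel
import Literature.AlgebraicGeometry.Motives.HodgeStructureCMActionReflexField
import Literature.AlgebraicGeometry.Motives.MumfordTateGroupOfStrongCMHodgeStructure
import Literature.AlgebraicGeometry.Motives.HodgeStructureOfOrientationPolarizable
import HarnessLib

/-!
# FOR AN ABSTRACT POLARIZABLE STRONG CM-HODGE STRUCTURE `(V, φ)`, `MT(V)(ℂ)` IS A QUOTIENT OF THE LEVEL `S^{E*}(ℂ)` OF THE SERRE GROUP,
# `E* = ℚ(Tr(φ(f)|V^{p,q})) ⊂ ℚ^{cm}` ITS OWN REFLEX FIELD — the least level with `X^*(MT) ⊆ X^*(S^E)`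
# (Milne–Shih, LNM 900 III §1 (1.5)–(1.7); Milne 1999 §1; Milne, *Complex Multiplication* §4 Prop. 4.21)

[topic AlgebraicGeometry/Motives]

Layer `Literature/AlgebraicGeometry/Motives`, lane `lit-hodgefound` (Track 2 foundations library; seat `lit-hodgefound-p02`, gen 33, row g33-#10).
THEOREMS ONLY (no definition, no named fact; D-0026 net debt `0`).  Junction BY NAME of g33-#2 `Motives/MumfordTateGroupOfOrientationSerreGroupLeastLevel`
(`Orientation.reflexLevel`, `isLeast_reflexLevel`, `exists_serreToGLLevel_reflexLevel`, `exists_serreToGLLevel_of_traceField_le_lift`: the least level of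
`MT(V^n_{(F,Π)})`), g33-#3 `Motives/HodgeStructureCMActionReflexField` (`EndAction.reflexField = E*`, strong case `reflexField_eq_traceField`), g31-#5
`Motives/MumfordTateGroupOfStrongCMHodgeStructure` (`nonempty_mumfordTateGroupBaseChange_mulEquiv_ofOrientation : MT(V)(ℂ) ≅ MT(V^n_{(F,Π_φ)})(ℂ)`) and
`Motives/HodgeStructureOfOrientationPolarizable` (`isPolarizable_iff_isPolarizable_ofOrientation`).  g31-#8 had `MT(V)(ℂ)` as a quotient of the full `S(ℂ)`
(`EndAction.exists_surjective_serreLimitPoints_mumfordTateGroupBaseChange`); here: of the finite level `S^{E*}`, with `E*` read off `(V, φ)` itself.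

THE PRINTS.  J. S. Milne, K.-y. Shih [MilneShih1982Taniyama] III §1 (held text p. 165–166): (1.5) p. 232 «pairs `(T,μ)` … `T` split over `L` and `μ` defined
over `L`», (1.6) «`MT(V,h) = T^λ` … the quotient of `S^L`», (1.7) «`S = lim← MT(V,h)` over the polarizable rational Hodge structures of CM-type».  J. S. Milne
[Milne1999] §1 p. 13 (the reflex field of `(V,h)`).  J. S. Milne [MilneCM2006] Ch. I §4 Prop. 4.21.  M. Green, P. Griffiths, M. Kerr [GreenGriffithsKerr2012]
§V.C (i) p. 161 (`(V, φ) ≅ Ξ(F, Π_φ)`).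

THE MECHANISM.  `V ≅ V^n_{(F,Π_φ)}` `F`-equivariantly (GGK's `Ξ`), whence `MT(V)(ℂ) ≅ MT(V_{Π_φ})(ℂ)` (g31-#5); g33-#2 factors `ρ_{Π_φ}` through
`S^{E*}`, `E* = (Π_φ)′ ∩ ℚ^{cm} = reflexLevel`, onto `MT(V_{Π_φ})(ℂ)`; and `(Π_φ)′ = E*(V, φ)` is the trace field of `φ` on the Hodge pieces (g33-#3).

WHAT IS PROVED (`A : EndAction H K`, `hS : [K:ℚ] = dim V`).  `lift_reflexLevel_orientation` (`E*` of the orientation, read in `ℂ`, is `E*(V, φ)`),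
`mem_reflexLevel_orientation_iff`, **`galSpan_mtCharCM_orientation_le_lambdaLevel_iff_reflexField_le`** (`X^*(MT(V)) ⊆ X^*(S^E) ⟺ E*(V,φ) ⊆ E`),
**`exists_surjective_serreLevelPoints_mumfordTateGroupBaseChange`** (`S^{E*}(ℂ) ↠ MT(V)(ℂ)`),
`exists_surjective_serreLevelPoints_mumfordTateGroupBaseChange_of_reflexField_le` (`S^E(ℂ) ↠ MT(V)(ℂ)` for every level `E ⊇ E*(V, φ)`).

HONEST SCOPE.  `ℂ`-points only; the surjection is g33-#2's `ρ^{E*}` followed by g31-#5's abstract isomorphism `MT(V_{Π_φ})(ℂ) ≅ MT(V)(ℂ)` (no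
compatibility with `μ_V` is asserted here — for that see g33-#6); leastness is the character-module statement of g33-#2 (`isLeast_reflexLevel`), read
through `E*(V, φ) = (Π_φ)′`.

## References
* [MilneShih1982Taniyama] J. S. Milne, K.-y. Shih, *Langlands's construction of the Taniyama group*, LNM 900 (1982), III §1 (1.5)–(1.7) pp. 232–233.
* [Milne1999] J. S. Milne, *Lefschetz motives and the Tate conjecture*, Compositio Math. 117 (1999), §1 (p. 13).
* [MilneCM2006] J. S. Milne, *Complex Multiplication* (course notes, 2006), Ch. I §4 Prop. 4.21.
* [GreenGriffithsKerr2012] M. Green, P. Griffiths, M. Kerr, *Mumford–Tate Groups and Domains* (2012), §V.C (i) p. 161.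

## Provenance
Lane `lit-hodgefound` (Hodge path, Track 2), prover seat `lit-hodgefound-p02` (generation 33), self-proposed row g33-#10.
-/

noncomputable section

open scoped TensorProduct Classical
open Module NumberField Cardinal

namespace Literature.AlgebraicGeometry.Motives

namespace HodgeStructure

namespace EndAction

open Literature.NumberTheory.ComplexMultiplication
open Literature.NumberTheory.ComplexMultiplication.CMNumbers
open Literature.NumberTheory.NumberFields (cmNumbers)

variable {K : Type} [Field K] [NumberField K] {n : ℤ}
variable {V : Type} [AddCommGroup V] [Module ℚ V] [Module.Finite ℚ V] {H : HodgeStructure V n}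
variable (A : EndAction H K)

/-- **The least level `E*` of the orientation `Π_φ`, read in `ℂ`, is the reflex field `E*(V, φ) = ℚ(Tr(φ(f)|V^{p,q}))`** (g33-#2 `lift_reflexLevel`, g33-#3
`reflexField_eq_traceField`). [cite: Milne1999, §1 (p. 13)] [cite: MilneShih1982Taniyama, III §1 (1.5)–(1.6) (p. 232)] -/
theorem lift_reflexLevel_orientation (hS : Module.finrank ℚ K = Module.finrank ℚ V) (hpol : (ofOrientation (A.orientation hS)).IsPolarizable) :
    IntermediateField.lift ((A.orientation hS).reflexLevel hpol) = A.reflexField := by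
  rw [Orientation.lift_reflexLevel, A.reflexField_eq_traceField hS]

/-- Membership: `x ∈ E* ⟺ x ∈ E*(V, φ)`. [cite: Milne1999, §1 (p. 13)] -/
theorem mem_reflexLevel_orientation_iff (hS : Module.finrank ℚ K = Module.finrank ℚ V) (hpol : (ofOrientation (A.orientation hS)).IsPolarizable)
    (x : cmNumbers) :
    x ∈ (A.orientation hS).reflexLevel hpol ↔ (x : ℂ) ∈ A.reflexField := by
  rw [Orientation.mem_reflexLevel_iff, A.reflexField_eq_traceField hS]

/-- **`X^*(MT(V)) = galSpan(λ̄_{θ₁}) ⊆ X^*(S^E)` iff `E*(V, φ) ⊆ E`**: the Mumford–Tate group of a polarizable strong CM-Hodge structure is a quotient of the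
level `S^E` exactly when `E` contains the field generated by the traces of `φ` on the Hodge pieces. [cite: MilneShih1982Taniyama, III §1 (1.5)–(1.6) (p. 232)]
[cite: Milne1999, §1 (p. 13)] -/
theorem galSpan_mtCharCM_orientation_le_lambdaLevel_iff_reflexField_le (hS : Module.finrank ℚ K = Module.finrank ℚ V)
    (hpol : (ofOrientation (A.orientation hS)).IsPolarizable) (θ₁ : K →+* ℂ) (E : IntermediateField ℚ cmNumbers) :
    galSpan ((A.orientation hS).mtCharCM θ₁) ≤ lambdaLevel E ↔ A.reflexField ≤ IntermediateField.lift E := by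
  rw [(A.orientation hS).galSpan_mtCharCM_le_lambdaLevel_iff_traceField_le hpol θ₁ E, A.reflexField_eq_traceField hS]

variable [HodgeTensorFacts.{0, 0}]

/-- **`S^E(ℂ) ↠ MT(V)(ℂ)` FOR EVERY LEVEL `E ⊇ E*(V, φ)`** of a polarizable strong CM-Hodge structure `(V, φ)`: g33-#2's `ρ^E_{Π_φ}` onto `MT(V_{Π_φ})(ℂ)`,
followed by g31-#5's `MT(V_{Π_φ})(ℂ) ≅ MT(V)(ℂ)`. [cite: MilneShih1982Taniyama, III §1 (1.5)–(1.7) (pp. 232–233)] [cite: MilneCM2006, Ch. I §4 Prop. 4.21]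
[cite: GreenGriffithsKerr2012, §V.C (i) p. 161] -/
theorem exists_surjective_serreLevelPoints_mumfordTateGroupBaseChange_of_reflexField_le (hS : Module.finrank ℚ K = Module.finrank ℚ V)
    (hpol : H.IsPolarizable) (E : IntermediateField ℚ cmNumbers) (hE : A.reflexField ≤ IntermediateField.lift E) :
    ∃ π : serreLevelPoints ℂ E →* H.mumfordTateGroupBaseChange ℂ, Function.Surjective π :=
  have hpol' : (ofOrientation (A.orientation hS)).IsPolarizable := (A.isPolarizable_iff_isPolarizable_ofOrientation hS).mp hpol
  have hE' : (A.orientation hS).traceField ≤ IntermediateField.lift E := A.reflexField_eq_traceField hS ▸ hE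
  -- (term-mode eliminations, as in g31-#8: destructuring with `obtain` makes the unification of the subgroup types expensive)
  (inferInstance : Nonempty (K →+* ℂ)).elim fun θ₁ =>
    (A.nonempty_mumfordTateGroupBaseChange_mulEquiv_ofOrientation hS ℂ).elim fun e =>
      ((A.orientation hS).exists_serreToGLLevel_of_traceField_le_lift hpol' θ₁ E hE').elim fun ρE h =>
        have π₁ : {π₁ : serreLevelPoints ℂ E →* (ofOrientation (A.orientation hS)).mumfordTateGroupBaseChange ℂ // Function.Surjective π₁} :=
          ⟨(MulEquiv.subgroupCongr h.2.1).toMonoidHom.comp ρE.rangeRestrict,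
            (MulEquiv.subgroupCongr h.2.1).surjective.comp ρE.rangeRestrict_surjective⟩
        ⟨e.symm.toMonoidHom.comp π₁.1, e.symm.surjective.comp π₁.2⟩

/-- **`S^{E*}(ℂ) ↠ MT(V)(ℂ)` AT THE REFLEX FIELD `E* = E*(V, φ)` OF THE CM-HODGE STRUCTURE ITSELF** — «`S = lim← MT(V,h)`», one polarizable CM Hodge
structure at a time, at its least level. [cite: MilneShih1982Taniyama, III §1 (1.5)–(1.7) (pp. 232–233)] [cite: Milne1999, §1 (p. 13)] [cite: MilneCM2006, Ch. I §4 Prop. 4.21] -/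
theorem exists_surjective_serreLevelPoints_mumfordTateGroupBaseChange (hS : Module.finrank ℚ K = Module.finrank ℚ V) (hpol : H.IsPolarizable) :
    ∃ π : serreLevelPoints ℂ ((A.orientation hS).reflexLevel ((A.isPolarizable_iff_isPolarizable_ofOrientation hS).mp hpol)) →*
      H.mumfordTateGroupBaseChange ℂ, Function.Surjective π :=
  A.exists_surjective_serreLevelPoints_mumfordTateGroupBaseChange_of_reflexField_le hS hpol _ (A.lift_reflexLevel_orientation hS _).ge

end EndAction

end HodgeStructure

end Literature.AlgebraicGeometry.Motives
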